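import Mathlib.RingTheory.TensorProduct.Quotient
import Mathlib.RingTheory.TensorProduct.MvPolynomial
import Mathlib.RingTheory.Ideal.Quotient.Operations
import HarnessLib

/-!
# Base change of a quotient of a polynomial ring: `(A[x] ⧸ I) ⊗_A k ≅ k[x] ⧸ I k[x]`

Topic: `Literature/AlgebraicGeometry/Resolution`. The fibres of the affine family
`Spec (A[x₁, …, xₙ] ⧸ I) → Spec A` at a ring-valued point `A → k` are the affine schemes
`Spec (k[x] ⧸ I k[x])`. The isomorphism is assembled from Mathlib:
`Algebra.TensorProduct.quotientTensorEquiv` (`(R ⧸ I) ⊗ T ≅ (R ⊗ T) ⧸ I (R ⊗ T)`),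
`Algebra.TensorProduct.comm`, `MvPolynomial.algebraTensorAlgEquiv` (`k ⊗_A A[x] ≅ k[x]`) and
`Ideal.quotientEquivAlg`; this file only packages it in the `MvPolynomial` shape used by
`EffectiveResolution*.lean` and records its values on generators:

* `polyBaseChange I k = I.map (map (algebraMap A k))` (abbreviation);
* `polyQuotientBaseChangeEquiv k I : (MvPolynomial σ A ⧸ I) ⊗[A] k ≃ₐ[A] MvPolynomial σ k ⧸ polyBaseChange I k`,
  `polyQuotientBaseChangeEquiv_tmul` (`x̄ ⊗ c ↦ x̄ · c`),
  `polyQuotientBaseChangeEquiv_symm_mk_map` (`(map r)‾ ↦ r̄ ⊗ 1`).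

## Sources

* A. Grothendieck, EGA I 4.3 (base change of affine schemes); Bourbaki, *Algèbre* II §3 no. 6.
  [folklore]
-/

noncomputable section

open TensorProduct MvPolynomial

namespace Literature.AlgebraicGeometry.Resolution

variable {A : Type*} (k : Type*) [CommRing A] [CommRing k] [Algebra A k] {σ : Type*}
  (I : Ideal (MvPolynomial σ A))

/-- The extended ideal `I k[x]`. [folklore] -/
abbrev polyBaseChange (I : Ideal (MvPolynomial σ A)) (k : Type*) [CommRing k] [Algebra A k] :
    Ideal (MvPolynomial σ k) :=
  I.map (MvPolynomial.map (algebraMap A k))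

variable (A σ) in
/-- The `A`-algebra isomorphism `A[x] ⊗_A k ≅ k[x]`, `r ⊗ c ↦ c · map r` (Mathlib's
`algebraTensorAlgEquiv` after swapping the factors). [folklore] -/
def polyTensorEquiv : MvPolynomial σ A ⊗[A] k ≃ₐ[A] MvPolynomial σ k :=
  (Algebra.TensorProduct.comm A (MvPolynomial σ A) k).trans
    ((MvPolynomial.algebraTensorAlgEquiv (σ := σ) A k).restrictScalars A)

/-- `polyTensorEquiv` on pure tensors. [folklore] -/
@[simp] theorem polyTensorEquiv_tmul (r : MvPolynomial σ A) (c : k) :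
    polyTensorEquiv A k σ (r ⊗ₜ[A] c) = c • MvPolynomial.map (algebraMap A k) r := by
  simp [polyTensorEquiv]

/-- `polyTensorEquiv ∘ includeLeft = map`. [folklore] -/
theorem polyTensorEquiv_comp_includeLeft :
    (polyTensorEquiv A k σ : MvPolynomial σ A ⊗[A] k →+* MvPolynomial σ k).comp
        (algebraMap (MvPolynomial σ A) (MvPolynomial σ A ⊗[A] k)) =
      MvPolynomial.map (algebraMap A k) := by
  refine RingHom.ext fun r => ?_
  simp [Algebra.TensorProduct.algebraMap_apply]

/-- The extended ideals correspond under `polyTensorEquiv`. [folklore] -/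
theorem polyBaseChange_eq_map_map :
    polyBaseChange I k =
      (I.map (algebraMap (MvPolynomial σ A) (MvPolynomial σ A ⊗[A] k))).map
        (polyTensorEquiv A k σ : MvPolynomial σ A ⊗[A] k →+* MvPolynomial σ k) := by
  rw [Ideal.map_map, polyTensorEquiv_comp_includeLeft]

/-- **`(A[x] ⧸ I) ⊗_A k ≅ k[x] ⧸ I k[x]`** (as `A`-algebras): base change of a quotient of a
polynomial ring, from Mathlib's `Algebra.TensorProduct.quotientTensorEquiv` and
`MvPolynomial.algebraTensorAlgEquiv`. [folklore] -/
def polyQuotientBaseChangeEquiv :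
    (MvPolynomial σ A ⧸ I) ⊗[A] k ≃ₐ[A] (MvPolynomial σ k ⧸ polyBaseChange I k) :=
  (Algebra.TensorProduct.quotientTensorEquiv (R := A) A k (MvPolynomial σ A) I).trans
    (Ideal.quotientEquivAlg _ _ (polyTensorEquiv A k σ) (polyBaseChange_eq_map_map k I))

/-- The isomorphism on pure tensors: `r̄ ⊗ c ↦ (map r)‾ · c`. [folklore] -/
@[simp] theorem polyQuotientBaseChangeEquiv_tmul (r : MvPolynomial σ A) (c : k) :
    polyQuotientBaseChangeEquiv k I (Ideal.Quotient.mk I r ⊗ₜ[A] c) =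
      Ideal.Quotient.mk _ (MvPolynomial.map (algebraMap A k) r) * algebraMap k _ c := by
  rw [polyQuotientBaseChangeEquiv, AlgEquiv.trans_apply,
    Algebra.TensorProduct.quotientTensorEquiv_apply_tmul]
  change Ideal.Quotient.mk _ (polyTensorEquiv A k σ (r ⊗ₜ[A] c)) = _
  rw [polyTensorEquiv_tmul, MvPolynomial.smul_eq_C_mul, map_mul, mul_comm]
  rfl

/-- The inverse isomorphism on `(map r)‾`. [folklore] -/
theorem polyQuotientBaseChangeEquiv_symm_mk_map (r : MvPolynomial σ A) :
    (polyQuotientBaseChangeEquiv k I).symm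
        (Ideal.Quotient.mk _ (MvPolynomial.map (algebraMap A k) r)) =
      Ideal.Quotient.mk I r ⊗ₜ[A] (1 : k) := by
  apply (polyQuotientBaseChangeEquiv k I).injective
  rw [AlgEquiv.apply_symm_apply, polyQuotientBaseChangeEquiv_tmul, map_one, mul_one]

end Literature.AlgebraicGeometry.Resolution

end
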